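import Literature.Geometry.Symplectic.PALFKasCritical
import Literature.Geometry.Symplectic.PALFKasProfiles
import Literature.Topology.FourManifolds.AdaptedMorseFromInterior
import Literature.Topology.FourManifolds.CollarTheorem
import HarnessLib

/-!
# Kas' handle decomposition of a Lefschetz fibration over the disc: the count

Topic `Literature/Geometry/Symplectic` (fact seat
`provefact-Literature.Geometry.Symplectic.Oba2016_s-add47373d4`; Kas 1980 §2, Gompf–Stipsicz 1999
§8.2).  Assembly of the bricks `PALFKasFunction.lean`, `PALFKasField.lean`,
`PALFKasCritical.lean`: for a positive allowable Lefschetz fibration `f : W → 𝔻²`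
(`Literature.Geometry.Symplectic.PALF`) and a Morse function `m` on the interior `F°` of a regular fibre with the
collar profile `bb ∘ τ`, Kas' function `G` is smooth on `W`, decreases along an inward field
near `∂W`, and its critical points in the compact set `{σ ≥ c/2}` are exactly the Lefschetz
points (nondegenerate of index `2`) and the points `incl q`, `q` critical for `m`
(nondegenerate, of the index of `m`).  The tree's
`Literature.Topology.FourManifolds.hasHandleDecomposition_of_interior` turns this into a handle decomposition.

* `KasSetup.finite_setOf_isMCriticalPt` — the critical set of the fibre Morse function is finite
  (a coordinate bound `|u i| ≤ ‖u‖` is Mathlib's `PiLp.norm_apply_le`, cf. the tree's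
  `Literature.Analysis.FluidPDE.FanPartition.abs_apply_le_norm`);
* `KasSetup.inter_criticalSetOfIndex_eq`, `KasSetup.ncard_inter_criticalSetOfIndex` — the count;
* `KasSetup.hasHandleDecomposition` — the handle decomposition, given the quantitative
  hypotheses (kernel field, vertical bound, domination of the bump term);
* `PALF.hasHandleDecomposition_of_fibreMorse` — **Theorem (Kas 1980, §2).**  There are a
  regular value `c₀`, a collar level `c > 0` and a regularity level `s₁ > 2c` of `τ = σ|F°`
  such that for EVERY collar profile `bb` and EVERY Morse function `m` on `F°` with
  `m = bb ∘ τ` on `{τ ≤ c}` and no critical point in `{τ ≤ 3c/2}`,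
  `W` has a handle decomposition with `#k-handles = #crit_k(m) + [k = 2] · #crit(f)`;
* `PALF.hasHandleDecomposition_fibreMorse` — the unconditional corollary (some such `m`
  exists, `PALFFibreMorse.lean`).

Everything is proved; no new definitions, no named facts.

## References

* A. Kas, *On the handlebody decomposition associated to a Lefschetz fibration*, Pacific J.
  Math. 89 (1980), §2. [Kas1980]
* R. E. Gompf, A. I. Stipsicz, *4-Manifolds and Kirby Calculus*, GSM 20 (1999), §8.2.
  [GompfStipsiczGSM1999]
* J. Milnor, *Morse theory*, Annals of Mathematics Studies 51 (1963), §2–3. [Milnor1963]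
-/

open scoped Manifold ContDiff Topology RealInnerProductSpace
open Set Function Filter

noncomputable section

namespace Literature.Geometry.Symplectic

open Literature.Topology.FourManifolds

universe u

/-! ### §0 Elementary bounds in `ℝ²` -/

/-- `‖u‖ ≤ 2a` when both coordinates are bounded by `a`. [folklore] -/
theorem norm_le_two_mul_of_forall_abs_le {u : EuclideanSpace ℝ (Fin 2)} {a : ℝ}
    (h : ∀ i, |u i| ≤ a) : ‖u‖ ≤ 2 * a := by
  have ha : 0 ≤ a := (abs_nonneg _).trans (h 0)
  rw [EuclideanSpace.norm_eq]
  have hs : ∑ i, ‖u i‖ ^ 2 ≤ (2 * a) ^ 2 := by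
    rw [Fin.sum_univ_two]
    have h0 := h 0
    have h1 := h 1
    rw [Real.norm_eq_abs, Real.norm_eq_abs]
    nlinarith [abs_nonneg (u 0), abs_nonneg (u 1)]
  calc Real.sqrt (∑ i, ‖u i‖ ^ 2) ≤ Real.sqrt ((2 * a) ^ 2) := Real.sqrt_le_sqrt hs
    _ = 2 * a := Real.sqrt_sq (by linarith)

/-- Some coordinate carries half the norm. [folklore] -/
theorem exists_half_norm_le_abs_apply (u : EuclideanSpace ℝ (Fin 2)) : ∃ i, ‖u‖ / 2 ≤ |u i| := by
  obtain ⟨i, -, hi⟩ := Finset.exists_max_image Finset.univ (fun i : Fin 2 => |u i|) Finset.univ_nonempty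
  refine ⟨i, ?_⟩
  have h := norm_le_two_mul_of_forall_abs_le (u := u) (a := |u i|) fun j => hi j (Finset.mem_univ j)
  linarith

variable {W : Type u} [TopologicalSpace W] [ChartedSpace (EuclideanHalfSpace 4) W]
  [IsManifold (𝓡∂ 4) ∞ W]
  {o : SmoothOrientation (𝓡∂ 4) W} {b : BoundaryData (𝓡∂ 4) W (𝓡 3)}

namespace PALF

/-- A point with `σ > 0` is an interior point. [folklore] -/
theorem isInteriorPoint_of_flowout_pos (D : FlowoutInput 3 W) {x : W} (hx : 0 < D.f x) :
    (𝓡∂ 4).IsInteriorPoint x := by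
  by_contra h
  have hb : x ∈ (𝓡∂ 4).boundary W := ((𝓡∂ 4).isInteriorPoint_or_isBoundaryPoint x).resolve_left h
  have := (D.f_eq_zero_iff x).2 hb
  linarith

/-- At a Lefschetz point `σ > 0`. [folklore] -/
theorem flowout_pos_of_mem_crit (P : PALF o b) (D : FlowoutInput 3 W) {p : W} (hp : p ∈ P.crit) :
    0 < D.f p := by
  rcases (D.f_nonneg p).lt_or_eq with h | h
  · exact h
  · exfalso
    have hb : p ∈ (𝓡∂ 4).boundary W := (D.f_eq_zero_iff p).1 h.symm
    exact ((𝓡∂ 4).disjoint_interior_boundary (M := W)).le_bot ⟨P.crit_subset_interior hp, hb⟩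

/-- A positive lower bound for `σ` on the (finite) critical set. [folklore] -/
theorem exists_pos_forall_le_flowout (P : PALF o b) (D : FlowoutInput 3 W) :
    ∃ σm : ℝ, 0 < σm ∧ ∀ p ∈ P.crit, σm ≤ D.f p := by
  by_cases hne : P.crit.Nonempty
  · obtain ⟨p₀, hp₀, hmin⟩ := P.crit.exists_min_image (fun p => D.f p) hne
    exact ⟨D.f p₀, P.flowout_pos_of_mem_crit D hp₀, hmin⟩
  · refine ⟨1, one_pos, fun p hp => ?_⟩
    exact absurd ⟨p, hp⟩ hne

/-- A positive lower bound for the distance from a regular value to the critical values.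
[folklore] -/
theorem exists_pos_forall_le_norm_sub (P : PALF o b) {c₀ : EuclideanSpace ℝ (Fin 2)}
    (hc : c₀ ∉ P.f '' ↑P.crit) : ∃ d : ℝ, 0 < d ∧ ∀ p ∈ P.crit, d ≤ ‖P.f p - c₀‖ := by
  by_cases hne : P.crit.Nonempty
  · obtain ⟨p₀, hp₀, hmin⟩ := P.crit.exists_min_image (fun p => ‖P.f p - c₀‖) hne
    refine ⟨‖P.f p₀ - c₀‖, norm_pos_iff.2 (sub_ne_zero.2 fun h => hc ⟨p₀, hp₀, h⟩), hmin⟩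
  · exact ⟨1, one_pos, fun p hp => absurd ⟨p, hp⟩ hne⟩

namespace KasSetup

variable {P : PALF o b} {D : FlowoutInput 3 W} (S : KasSetup P D)

/-! ### §1 Finiteness of the fibre critical set -/

/-- **The fibre Morse function has finitely many critical points**: they are nondegenerate,
hence isolated (Milnor 1963, Cor. 2.3), and lie in the compact set `{τ ≥ 3c/2}`.
[cite: Milnor1963, Cor. 2.3] -/
theorem finite_setOf_isMCriticalPt [T2Space W] [CompactSpace W] :
    {q : RegularFibreOn S.hF | IsMCriticalPt (𝓡 2) S.m q}.Finite := by
  have h2 : (2 : WithTop ℕ∞) ≤ ∞ := by norm_cast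
  have hK : IsCompact {q : RegularFibreOn S.hF |
      3 * S.c / 2 ≤ D.f (RegularFibreOn.incl S.hF q)} :=
    P.isCompact_tau_preimage_Ici D S.hc (by linarith [S.hc0])
  have hsub : {q : RegularFibreOn S.hF | IsMCriticalPt (𝓡 2) S.m q} ⊆
      {q | 3 * S.c / 2 ≤ D.f (RegularFibreOn.incl S.hF q)} := fun q hq => (S.hmcrit q hq).le
  have hcl : IsClosed {q : RegularFibreOn S.hF | IsMCriticalPt (𝓡 2) S.m q} :=
    isClosed_criticalSet_of_contMDiff S.hm.1 h2
  have hcpt : IsCompact {q : RegularFibreOn S.hF | IsMCriticalPt (𝓡 2) S.m q} :=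
    hK.of_isClosed_subset hcl hsub
  obtain ⟨t, -, hcover⟩ := hcpt.elim_nhds_subcover
    (fun p => {x | x = p ∨ ¬ IsMCriticalPt (𝓡 2) S.m x}) fun p hp => by
      have := eventually_not_isMCriticalPt_of_nondegenerate S.hm.1 h2 hp (S.hm.2 p hp)
      rw [eventually_nhdsWithin_iff] at this
      filter_upwards [this] with x hx
      by_cases hxp : x = p
      · exact Or.inl hxp
      · exact Or.inr (hx hxp)
  refine t.finite_toSet.subset fun x hx => ?_
  obtain ⟨p, hp, hxp⟩ := mem_iUnion₂.1 (hcover hx)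
  rcases hxp with h | h
  · rw [h]; exact hp
  · exact absurd hx h

/-! ### §2 The critical points in `{σ ≥ κ}`: nondegeneracy and count -/

/-- The dichotomy used by `classification`: a point lies over the open `δ`-box or off the
closed `δ''`-box. [folklore] -/
theorem hmid (x : W) : (∀ i, |P.f x i - S.c₀ i| < S.δ) ∨ ∃ i, S.δ'' < |P.f x i - S.c₀ i| := by
  by_cases h : ∀ i, |P.f x i - S.c₀ i| < S.δ
  · exact Or.inl h
  · push Not at h
    obtain ⟨i, hi⟩ := h
    exact Or.inr ⟨i, lt_of_lt_of_le S.hδ''δ hi⟩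


section Count

variable (htube : ∀ x ∈ S.tube, P.f x ≠ S.c₀ → ¬ IsMCriticalPt (𝓡∂ 4) S.G x)
  (hoff : ∀ x, (∃ i, S.δ'' < |P.f x i - S.c₀ i|) → D.f x < 2 * S.c → ¬ IsMCriticalPt (𝓡∂ 4) S.G x)
  (hcritσ : ∀ p ∈ P.crit, 2 * S.c < D.f p)
  (hcritbox : ∀ p ∈ P.crit, ∃ i, S.δ'' < |P.f p i - S.c₀ i|)

include htube hoff hcritσ hcritbox

/-- **Every critical point of `G` in the interior is nondegenerate** (Kas 1980, §2).
[cite: Kas1980, §2] -/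
theorem nondegenerate_of_isMCriticalPt {x : W} (hxi : (𝓡∂ 4).IsInteriorPoint x)
    (hcrit : IsMCriticalPt (𝓡∂ 4) S.G x) : (mhessian (𝓡∂ 4) S.G x).Nondegenerate := by
  rcases S.classification htube hoff (S.hmid) hxi hcrit with hp | ⟨q, hqx, hq⟩
  · exact (S.morseData_of_mem_crit hp (hcritbox x hp) (hcritσ x hp)).2.1
  · rw [← hqx]; exact ((S.morseData_incl q).2 hq).1

/-- **The critical points of index `k` in `{σ ≥ κ}`** (`0 < κ ≤ 3c/2`) are the points
`incl q`, `q` critical of index `k` for `m`, together with the Lefschetz points when `k = 2`.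
[cite: Kas1980, §2] -/
theorem inter_criticalSetOfIndex_eq {κ : ℝ} (hκ0 : 0 < κ) (hκc : κ ≤ 3 * S.c / 2) (k : ℕ) :
    {x : W | κ ≤ D.f x} ∩ criticalSetOfIndex (𝓡∂ 4) S.G k =
      RegularFibreOn.incl S.hF '' criticalSetOfIndex (𝓡 2) S.m k ∪
        (if k = 2 then (↑P.crit : Set W) else ∅) := by
  ext x
  simp only [mem_inter_iff, mem_setOf_eq, criticalSetOfIndex, mem_union, mem_image]
  constructor
  · rintro ⟨hxK, hcrit, hidx⟩
    have hxi : (𝓡∂ 4).IsInteriorPoint x := isInteriorPoint_of_flowout_pos D (lt_of_lt_of_le hκ0 hxK)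
    rcases S.classification htube hoff (S.hmid) hxi hcrit with hp | ⟨q, hqx, hq⟩
    · right
      have h2 := (S.morseData_of_mem_crit hp (hcritbox x hp) (hcritσ x hp)).2.2
      rw [h2] at hidx
      subst hidx
      simpa using hp
    · left
      refine ⟨q, ⟨hq, ?_⟩, hqx⟩
      have h := ((S.morseData_incl q).2 hq).2
      rw [hqx] at h
      rw [← h, hidx]
  · rintro (⟨q, ⟨hq, hqi⟩, hqx⟩ | hx)
    · subst hqx
      refine ⟨le_trans hκc (S.hmcrit q hq).le, (S.morseData_incl q).1.2 hq, ?_⟩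
      rw [((S.morseData_incl q).2 hq).2, hqi]
    · by_cases hk : k = 2
      · subst hk
        simp only [if_true, Finset.mem_coe] at hx
        obtain ⟨hc, -, hidx⟩ := S.morseData_of_mem_crit hx (hcritbox x hx) (hcritσ x hx)
        exact ⟨by linarith [hcritσ x hx, S.hc0], hc, hidx⟩
      · simp [hk] at hx

/-- **The count**: `#(crit_k(G) ∩ {σ ≥ κ}) = #crit_k(m) + [k = 2] · #crit(f)`. [cite: Kas1980, §2] -/
theorem ncard_inter_criticalSetOfIndex [T2Space W] [CompactSpace W] {κ : ℝ} (hκ0 : 0 < κ)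
    (hκc : κ ≤ 3 * S.c / 2) (k : ℕ) :
    ({x : W | κ ≤ D.f x} ∩ criticalSetOfIndex (𝓡∂ 4) S.G k).ncard =
      (criticalSetOfIndex (𝓡 2) S.m k).ncard + if k = 2 then P.crit.card else 0 := by
  rw [S.inter_criticalSetOfIndex_eq htube hoff hcritσ hcritbox hκ0 hκc k]
  have hfin₁ : (criticalSetOfIndex (𝓡 2) S.m k).Finite :=
    S.finite_setOf_isMCriticalPt.subset fun q hq => hq.1
  have hdisj : Disjoint (RegularFibreOn.incl S.hF '' criticalSetOfIndex (𝓡 2) S.m k)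
      (if k = 2 then (↑P.crit : Set W) else ∅) := by
    rw [Set.disjoint_left]
    rintro x ⟨q, -, rfl⟩ hx
    by_cases hk : k = 2
    · simp only [hk, if_true, Finset.mem_coe] at hx
      obtain ⟨i, hi⟩ := hcritbox _ hx
      rw [RegularFibreOn.apply_incl S.hF q, sub_self, abs_zero] at hi
      linarith [S.hδ', S.hδ'δ'']
    · simp [hk] at hx
  have hfin₂ : (if k = 2 then (↑P.crit : Set W) else ∅).Finite := by
    split_ifs
    · exact P.crit.finite_toSet
    · exact finite_empty
  rw [Set.ncard_union_eq hdisj (hfin₁.image _) hfin₂,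
    Set.ncard_image_of_injective _ (show Injective (RegularFibreOn.incl S.hF) from Subtype.val_injective)]
  congr 1
  split_ifs
  · exact Set.ncard_coe_finset _
  · exact Set.ncard_empty _

end Count

/-! ### §3 The handle decomposition from a Kas setup -/

/-- **The handle decomposition of a Kas setup** (Kas 1980, §2; Gompf–Stipsicz 1999, §8.2):
given the kernel field `ν` over the disc of radius `r`, the vertical bound beyond `r₄ < r`,
the level inequalities `2c < s₁, D.δ, σ(crit f)`, the box avoidance of the critical values,
`bb' < 0` below `2c` and the domination of the bump term on the tube, `W` has a handle
decomposition with `#k-handles = #crit_k(m) + [k = 2] · #crit(f)`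
(`Literature.Topology.FourManifolds.hasHandleDecomposition_of_interior` with `K = {σ ≥ c/2}` and the inward Lyapunov
field of `PALF.exists_kasField`). [cite: Kas1980, §2] [cite: GompfStipsiczGSM1999, §8.2] -/
theorem hasHandleDecomposition [T2Space W] [CompactSpace W] {r₄ r s₁ : ℝ}
    (hr₄ : 0 ≤ r₄) (hr₄r : r₄ < r) (hrr : ∀ x, ‖P.f x‖ ≤ r ∨ r₄ ≤ ‖P.f x‖)
    (hvert : ∀ x, r₄ ≤ ‖P.f x‖ →
      ⟪P.f x - S.c₀, mfderiv (𝓡∂ 4) 𝓘(ℝ, EuclideanSpace ℝ (Fin 2)) P.f x (D.ξ x)⟫ < 0)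
    {ν : Π x : W, TangentSpace (𝓡∂ 4) x}
    (hνs : ContMDiff (𝓡∂ 4) (𝓡∂ 4).tangent ∞ (fun x => (⟨x, ν x⟩ : TangentBundle (𝓡∂ 4) W)))
    (hνw : ∀ z ∈ (𝓡∂ 4).boundary W, 0 ≤ halfSpaceCoord 3 (ν z))
    (hνk : ∀ x, ‖P.f x‖ ≤ r → mfderiv (𝓡∂ 4) 𝓘(ℝ, EuclideanSpace ℝ (Fin 2)) P.f x (ν x) = 0)
    (hs₁ν : ∀ x, ‖P.f x‖ ≤ r → D.f x < s₁ → 0 < mlineDeriv (𝓡∂ 4) D.f x (ν x))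
    (h2cs₁ : 2 * S.c < s₁) (h2cD : 2 * S.c < D.δ)
    (hcritσ : ∀ p ∈ P.crit, 2 * S.c < D.f p)
    (hcritbox : ∀ p ∈ P.crit, ∃ i, S.δ'' < |P.f p i - S.c₀ i|)
    (hbb' : ∀ t, t < 2 * S.c → deriv S.bb t < 0)
    (hdom : ∀ x ∈ S.tube, (∃ i, S.δ' ≤ |P.f x i - S.c₀ i|) →
      S.ε * |S.Dfun x * fderiv ℝ S.β (P.f x) (P.f x - S.c₀)| < 2 * ‖P.f x - S.c₀‖ ^ 2) :
    HasHandleDecomposition 3 W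
      (fun k => (criticalSetOfIndex (𝓡 2) S.m k).ncard + if k = 2 then P.crit.card else 0) := by
  -- the two exclusion statements
  have htube : ∀ x ∈ S.tube, P.f x ≠ S.c₀ → ¬ IsMCriticalPt (𝓡∂ 4) S.G x := by
    intro x hx hne
    refine S.not_isMCriticalPt_of_mem_tube hx ?_
    by_cases h : ∀ i, |P.f x i - S.c₀ i| < S.δ'
    · exact S.dom_of_mem_innerBox h hne
    · push Not at h
      exact hdom x hx h
  have hoff : ∀ x, (∃ i, S.δ'' < |P.f x i - S.c₀ i|) → D.f x < 2 * S.c →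
      ¬ IsMCriticalPt (𝓡∂ 4) S.G x := by
    intro x hx hσ
    rcases hrr x with h | h
    · exact S.not_isMCriticalPt_of_kernelField hx (hνk x h) (hs₁ν x h (hσ.trans h2cs₁))
        (hbb' _ hσ)
    · exact S.not_isMCriticalPt_of_flowout hx (hvert x h) (le_of_lt (hσ.trans h2cD)) (hbb' _ hσ)
  -- the inward Lyapunov field
  have hκc : S.c / 2 < S.c := by linarith [S.hc0]
  obtain ⟨Z, hZs, hZin, hZG⟩ := P.exists_kasField D hr₄ hr₄r le_rfl hvert hνs hνw hνk hs₁ν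
    (κ := S.c / 2) (c := S.c) (ε := S.ε) hκc (by linarith) (by linarith) S.hε S.hbb
    (fun t ht => hbb' t (by linarith [ht.2, S.hc0]))
    (G := S.G) (fun x hx => S.G_eventuallyEq_G₀_of_lt hx)
  -- the endgame
  have hK : IsCompact {x : W | S.c / 2 ≤ D.f x} :=
    (isClosed_le continuous_const D.f_smooth.continuous).isCompact
  have hKint : {x : W | S.c / 2 ≤ D.f x} ⊆ (𝓡∂ 4).interior W := fun x hx =>
    isInteriorPoint_of_flowout_pos D (lt_of_lt_of_le (by linarith [S.hc0]) hx)
  refine hasHandleDecomposition_of_interior (n := 3) (fun x _ => S.contMDiff_G x) hZs hZin hK hKint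
    (fun x _ hxK => hZG x (not_le.1 hxK)) (fun x hx hcrit => ?_) (fun k => ?_)
  · exact S.nondegenerate_of_isMCriticalPt htube hoff hcritσ hcritbox (hKint hx) hcrit
  · exact S.ncard_inter_criticalSetOfIndex htube hoff hcritσ hcritbox (by linarith [S.hc0])
      (by linarith [S.hc0]) k

/-! ### §4 Bounds for the domination of the bump term -/

/-- A uniform bound for the fibre term on the tube. [folklore] -/
theorem exists_forall_abs_Dfun_le [T2Space W] [CompactSpace W] :
    ∃ Dm : ℝ, 0 ≤ Dm ∧ ∀ x ∈ S.tube, |S.Dfun x| ≤ Dm := by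
  -- bound for `m`
  have hK : IsCompact {q : RegularFibreOn S.hF | S.c ≤ D.f (RegularFibreOn.incl S.hF q)} :=
    P.isCompact_tau_preimage_Ici D S.hc S.hc0
  obtain ⟨M₁, hM₁⟩ := hK.exists_bound_of_continuousOn (f := S.m) S.hm.1.continuous.continuousOn
  -- bound for `bb` on `[0, 2c]`
  obtain ⟨M₂, hM₂⟩ := (isCompact_Icc (a := (0 : ℝ)) (b := 2 * S.c)).exists_bound_of_continuousOn
    (f := S.bb) S.hbb.continuous.continuousOn
  have hbb_le : ∀ t, 0 ≤ t → |S.bb t| ≤ M₂ := by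
    intro t ht
    rcases le_or_gt t (2 * S.c) with h | h
    · have := hM₂ t ⟨ht, h⟩; rwa [Real.norm_eq_abs] at this
    · rw [S.hbb_const t h.le]
      have := hM₂ (2 * S.c) ⟨by linarith [S.hc0], le_rfl⟩; rwa [Real.norm_eq_abs] at this
  have hm_le : ∀ q : RegularFibreOn S.hF, |S.m q| ≤ max M₁ M₂ := by
    intro q
    rcases le_or_gt S.c (D.f (RegularFibreOn.incl S.hF q)) with h | h
    · have := hM₁ q h
      rw [Real.norm_eq_abs] at this
      exact this.trans (le_max_left _ _)
    · rw [S.hmcol q h.le]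
      exact (hbb_le _ (D.f_nonneg _)).trans (le_max_right _ _)
  have h0 : 0 ≤ max M₁ M₂ + M₂ := by
    have h1 : 0 ≤ M₂ := (abs_nonneg _).trans (hbb_le 0 le_rfl)
    have h2 : 0 ≤ max M₁ M₂ := h1.trans (le_max_right _ _)
    linarith
  refine ⟨max M₁ M₂ + M₂, h0, fun x hx => ?_⟩
  rw [S.Dfun_eq_of_mem hx ⟨S.B.Ψ x, S.B.Ψ_mem hx.1 hx.2⟩]
  have h1 := hm_le (S.B.psiHat S.hF ⟨S.B.Ψ x, S.B.Ψ_mem hx.1 hx.2⟩ x)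
  have h2 := hbb_le (D.f x) (D.f_nonneg x)
  calc |S.m (S.B.psiHat S.hF ⟨S.B.Ψ x, S.B.Ψ_mem hx.1 hx.2⟩ x) - S.bb (D.f x)|
      ≤ |S.m (S.B.psiHat S.hF ⟨S.B.Ψ x, S.B.Ψ_mem hx.1 hx.2⟩ x)| + |S.bb (D.f x)| := abs_sub _ _
    _ ≤ max M₁ M₂ + M₂ := add_le_add h1 h2

/-- A uniform bound for `dβ` over the base. [folklore] -/
theorem exists_forall_norm_fderiv_β_le :
    ∃ Bβ : ℝ, 0 ≤ Bβ ∧ ∀ x : W, ‖fderiv ℝ S.β (P.f x)‖ ≤ Bβ := by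
  obtain ⟨B, hB⟩ := (isCompact_closedBall (0 : EuclideanSpace ℝ (Fin 2)) 1).exists_bound_of_continuousOn
    (f := fderiv ℝ S.β) (S.hβ.continuous_fderiv (by simp)).continuousOn
  refine ⟨max B 0, le_max_right _ _, fun x => (hB (P.f x) ?_).trans (le_max_left _ _)⟩
  rw [Metric.mem_closedBall, dist_zero_right]
  exact P.norm_apply_le_one x

/-- **Domination of the bump term** for small `ε`: if `ε (Dm Bβ) < 2δ'`... precisely, if
`ε * (Dm * Bβ) < 2 * δ'` with `|Dfun| ≤ Dm` on the tube and `‖dβ‖ ≤ Bβ`, then the domination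
hypothesis of `hasHandleDecomposition` holds. [folklore] -/
theorem dom_of_small {Dm Bβ : ℝ} (hDm0 : 0 ≤ Dm) (hDm : ∀ x ∈ S.tube, |S.Dfun x| ≤ Dm)
    (hBβ : ∀ x : W, ‖fderiv ℝ S.β (P.f x)‖ ≤ Bβ)
    (hε : S.ε * (Dm * Bβ) < 2 * S.δ') {x : W} (hx : x ∈ S.tube) (hx' : ∃ i, S.δ' ≤ |P.f x i - S.c₀ i|) :
    S.ε * |S.Dfun x * fderiv ℝ S.β (P.f x) (P.f x - S.c₀)| < 2 * ‖P.f x - S.c₀‖ ^ 2 := by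
  obtain ⟨i, hi⟩ := hx'
  set n := ‖P.f x - S.c₀‖ with hn
  have hni : S.δ' ≤ n := hi.trans (by
    have := PiLp.norm_apply_le (P.f x - S.c₀) i
    rw [Real.norm_eq_abs] at this
    simpa using this)
  have hn0 : 0 < n := lt_of_lt_of_le S.hδ' hni
  have h1 : |S.Dfun x * fderiv ℝ S.β (P.f x) (P.f x - S.c₀)| ≤ Dm * (Bβ * n) := by
    rw [abs_mul]
    refine mul_le_mul (hDm x hx) ?_ (abs_nonneg _) hDm0
    rw [← Real.norm_eq_abs]
    exact (ContinuousLinearMap.le_opNorm _ _).trans (mul_le_mul_of_nonneg_right (hBβ x) (norm_nonneg _))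
  have h2 : S.ε * |S.Dfun x * fderiv ℝ S.β (P.f x) (P.f x - S.c₀)| ≤ S.ε * (Dm * Bβ) * n := by
    have := mul_le_mul_of_nonneg_left h1 S.hε.le
    linarith [this]
  have h3 : S.ε * (Dm * Bβ) * n < 2 * S.δ' * n := mul_lt_mul_of_pos_right hε hn0
  have h4 : 2 * S.δ' * n ≤ 2 * n ^ 2 := by nlinarith
  linarith

end KasSetup

/-! ### §5 Kas' theorem for a PALF over the disc -/

section Main

variable [T2Space W] [CompactSpace W]

/-- **Theorem (Kas 1980, §2; Gompf–Stipsicz 1999, §8.2) — the handle decomposition of a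
Lefschetz fibration over the disc from a Morse function on the fibre.**  For a positive
allowable Lefschetz fibration `f : W⁴ → 𝔻²` (`Literature.Geometry.Symplectic.PALF`) there are flow-out data `D`
(collar coordinate `σ = D.f`), a regular value `c₀` of `f` of norm `< ρ'` (any `ρ' > 0`), a
collar level `c > 0` and a level `s₁ > 2c` below which `τ = σ ∘ incl` has no critical point on the
interior `F°` of the fibre over `c₀`, such that: for every smooth profile `bb` constant on
`[2c, ∞)` with `bb' < 0` below `2c`, and every Morse function `m` on `F°` with `m = bb ∘ τ`
on `{τ ≤ c}` and all critical points in `{τ > 3c/2}`, the manifold `W` admits a handle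
decomposition with exactly `#crit_k(m) + [k = 2] · #crit(f)` handles of index `k`
(`Literature.Topology.FourManifolds.HasHandleDecomposition`). [cite: Kas1980, §2] [cite: GompfStipsiczGSM1999, §8.2] -/
theorem hasHandleDecomposition_of_fibreMorse (P : PALF o b) {ρ' : ℝ} (hρ' : 0 < ρ') :
    ∃ (D : FlowoutInput 3 W) (c₀ : EuclideanSpace ℝ (Fin 2)) (hc : c₀ ∉ P.f '' ↑P.crit) (c s₁ : ℝ),
      ‖c₀‖ < ρ' ∧ 0 < c ∧ 2 * c < s₁ ∧
      (∀ q : RegularFibreOn (P.isRegularFibreOn_interior hc),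
        D.f (RegularFibreOn.incl (P.isRegularFibreOn_interior hc) q) < s₁ →
          ¬ IsMCriticalPt (𝓡 2)
            (fun q : RegularFibreOn (P.isRegularFibreOn_interior hc) =>
              D.f (RegularFibreOn.incl (P.isRegularFibreOn_interior hc) q)) q) ∧
      ∀ (bb : ℝ → ℝ), ContDiff ℝ ∞ bb → (∀ t, 2 * c ≤ t → bb t = bb (2 * c)) →
        (∀ t, t < 2 * c → deriv bb t < 0) →
        ∀ (m : RegularFibreOn (P.isRegularFibreOn_interior hc) → ℝ), IsMorse (𝓡 2) m →
          (∀ q, D.f (RegularFibreOn.incl (P.isRegularFibreOn_interior hc) q) ≤ c →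
            m q = bb (D.f (RegularFibreOn.incl (P.isRegularFibreOn_interior hc) q))) →
          (∀ q, IsMCriticalPt (𝓡 2) m q →
            3 * c / 2 < D.f (RegularFibreOn.incl (P.isRegularFibreOn_interior hc) q)) →
          HasHandleDecomposition 3 W
            (fun k => (criticalSetOfIndex (𝓡 2) m k).ncard + if k = 2 then P.crit.card else 0) := by
  -- flow-out data and the vertical bound
  set D : FlowoutInput 3 W := Classical.choice (nonempty_flowoutInput (n := 2) (M := W)) with hD
  obtain ⟨r₄, hr₄0, hr₄1, ρ₀, hρ₀, hvert⟩ := P.exists_vertical_bound D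
  set r : ℝ := (r₄ + 1) / 2 with hr
  have hr₄r : r₄ < r := by rw [hr]; linarith
  have hr1 : r < 1 := by rw [hr]; linarith
  have hr0 : 0 < r := by rw [hr]; linarith
  -- the regular value
  set ρ : ℝ := min (min ρ₀ (r / 2)) ρ' with hρ
  have hρ0 : 0 < ρ := lt_min (lt_min hρ₀ (by linarith)) hρ'
  obtain ⟨c₀, hc₀U, hc⟩ := P.exists_not_mem_image_crit (U := Metric.ball 0 ρ) Metric.isOpen_ball
    ⟨0, Metric.mem_ball_self hρ0⟩
  rw [Metric.mem_ball, dist_zero_right] at hc₀U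
  have hc₀ρ₀ : ‖c₀‖ ≤ ρ₀ := hc₀U.le.trans ((min_le_left _ _).trans (min_le_left _ _))
  have hc₀r2 : ‖c₀‖ ≤ r / 2 := hc₀U.le.trans ((min_le_left _ _).trans (min_le_right _ _))
  have hc₀ρ' : ‖c₀‖ < ρ' := lt_of_lt_of_le hc₀U (min_le_right _ _)
  have hvert' : ∀ x, r₄ ≤ ‖P.f x‖ →
      ⟪P.f x - c₀, mfderiv (𝓡∂ 4) 𝓘(ℝ, EuclideanSpace ℝ (Fin 2)) P.f x (D.ξ x)⟫ < 0 :=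
    fun x hx => hvert x hx c₀ hc₀ρ₀
  -- the box
  obtain ⟨d, hd0, hd⟩ := P.exists_pos_forall_le_norm_sub hc
  set δ : ℝ := min (d / 4) ((r - ‖c₀‖) / 2) with hδ
  have hδ0 : 0 < δ := lt_min (by linarith) (by linarith)
  have hδd : δ ≤ d / 4 := min_le_left _ _
  have hδr : δ ≤ (r - ‖c₀‖) / 2 := min_le_right _ _
  have hΔ : ∀ u : EuclideanSpace ℝ (Fin 2), (∀ i, |u i - c₀ i| ≤ δ) → ‖u‖ ≤ r := by
    intro u hu
    have h1 : ‖u - c₀‖ ≤ 2 * δ := norm_le_two_mul_of_forall_abs_le fun i => by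
      simpa using hu i
    have h2 : ‖u‖ ≤ ‖c₀‖ + ‖u - c₀‖ := by
      have := norm_add_le c₀ (u - c₀); rwa [add_sub_cancel] at this
    linarith
  have hcritΔ : ∀ p ∈ P.crit, ∃ i, δ < |P.f p i - c₀ i| := by
    intro p hp
    obtain ⟨i, hi⟩ := exists_half_norm_le_abs_apply (P.f p - c₀)
    refine ⟨i, lt_of_lt_of_le ?_ (by simpa using hi)⟩
    linarith [hd p hp]
  obtain ⟨s₀, hs₀, B, hΦlev, hΨlev⟩ := P.exists_boxProduct_level D (le_refl δ) hr1 hΔ hcritΔ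
  -- the kernel field and the regularity levels
  obtain ⟨ν, hνs, hνw, hνk, hνin⟩ := P.exists_kernel_field_inward hr1
  obtain ⟨s₁, hs₁, hs₁ν⟩ := P.exists_pos_forall_mlineDeriv_pos D hνs hνin
  obtain ⟨s₁F, hs₁F, hs₁Freg⟩ := P.exists_pos_forall_not_isMCriticalPt_tau D hc
    (hc₀r2.trans (by linarith)) hr1
  obtain ⟨σm, hσm, hσmle⟩ := P.exists_pos_forall_le_flowout D
  -- the collar level
  set M : ℝ := min (min (min s₀ s₁) (min s₁F D.δ)) σm with hM
  have hM0 : 0 < M := lt_min (lt_min (lt_min hs₀ hs₁) (lt_min hs₁F D.δ_pos)) hσm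
  have hMs₀ : M ≤ s₀ := (min_le_left _ _).trans ((min_le_left _ _).trans (min_le_left _ _))
  have hMs₁ : M ≤ s₁ := (min_le_left _ _).trans ((min_le_left _ _).trans (min_le_right _ _))
  have hMs₁F : M ≤ s₁F := (min_le_left _ _).trans ((min_le_right _ _).trans (min_le_left _ _))
  have hMD : M ≤ D.δ := (min_le_left _ _).trans ((min_le_right _ _).trans (min_le_right _ _))
  have hMσ : M ≤ σm := min_le_right _ _
  set c : ℝ := M / 3 with hcdef
  have hc0 : 0 < c := by rw [hcdef]; linarith
  have h2cM : 2 * c < M := by rw [hcdef]; linarith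
  refine ⟨D, c₀, hc, c, s₁F, hc₀ρ', hc0, lt_of_lt_of_le h2cM hMs₁F, hs₁Freg,
    fun bb hbb hbb_const hbb' m hm hmcol hmcrit => ?_⟩
  -- the bump and a first setup (with `ε = 1`) to measure the fibre term
  obtain ⟨β, hβ, hβ1, hβ0⟩ := exists_boxBump c₀ (δ' := δ / 3) (δ'' := 2 * δ / 3) (by linarith) (by linarith)
  set S₁ : KasSetup P D :=
    { c₀ := c₀, δ' := δ / 3, δ'' := 2 * δ / 3, δ := δ, hδ' := by linarith, hδ'δ'' := by linarith,
      hδ''δ := by linarith, hc := hc, B := B, s₀ := s₀, hΨlev := hΨlev, hΦlev := hΦlev, c := c,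
      hc0 := hc0, hcs₀ := (le_of_lt h2cM).trans hMs₀, bb := bb, hbb := hbb, hbb_const := hbb_const,
      m := m, hm := hm, hmcol := hmcol, hmcrit := hmcrit, β := β, hβ := hβ, hβ1 := hβ1, hβ0 := hβ0,
      ε := 1, hε := one_pos } with hS₁
  obtain ⟨Dm, hDm0, hDm⟩ := S₁.exists_forall_abs_Dfun_le
  obtain ⟨Bβ, hBβ0, hBβ⟩ := S₁.exists_forall_norm_fderiv_β_le
  -- the setup
  set ε : ℝ := (δ / 3) / (Dm * Bβ + 1) with hεdef
  have hε0 : 0 < ε := div_pos (by linarith) (by positivity)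
  have hεdom : ε * (Dm * Bβ) < 2 * (δ / 3) := by
    have h1 : ε * (Dm * Bβ + 1) = δ / 3 := by
      rw [hεdef]; field_simp
    have h2 : ε * (Dm * Bβ) < ε * (Dm * Bβ + 1) := by nlinarith
    linarith
  set S : KasSetup P D := { S₁ with ε := ε, hε := hε0 } with hS
  have hDfun : ∀ x, S.Dfun x = S₁.Dfun x := fun x => rfl
  have htubeS : S.tube = S₁.tube := rfl
  -- the hypotheses of `KasSetup.hasHandleDecomposition`
  have hrr : ∀ x, ‖P.f x‖ ≤ r ∨ r₄ ≤ ‖P.f x‖ := fun x =>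
    (le_or_gt ‖P.f x‖ r).imp id fun h => hr₄r.le.trans h.le
  have hdom : ∀ x ∈ S.tube, (∃ i, S.δ' ≤ |P.f x i - S.c₀ i|) →
      S.ε * |S.Dfun x * fderiv ℝ S.β (P.f x) (P.f x - S.c₀)| < 2 * ‖P.f x - S.c₀‖ ^ 2 := by
    intro x hx hx'
    exact S.dom_of_small hDm0 (fun y hy => (hDfun y).symm ▸ hDm y (htubeS ▸ hy)) hBβ hεdom hx hx'
  exact S.hasHandleDecomposition hr₄0 hr₄r hrr hvert' hνs hνw hνk hs₁ν (lt_of_lt_of_le h2cM hMs₁)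
    (lt_of_lt_of_le h2cM hMD) (fun p hp => lt_of_lt_of_le h2cM (hMσ.trans (hσmle p hp)))
    (fun p hp => by
      obtain ⟨i, hi⟩ := hcritΔ p hp
      exact ⟨i, lt_trans (by show 2 * δ / 3 < δ; linarith) hi⟩)
    hbb' hdom

/-- **Corollary (Kas 1980, §2).**  A positive allowable Lefschetz fibration over the disc
admits a handle decomposition with `#crit_k(m) + [k = 2] · #crit(f)` handles of index `k`,
for some Morse function `m` with finitely many critical points on the interior of a regular
fibre (`PALF.exists_fibreMorse` supplies `m` with the collar profile
`Literature.Geometry.Symplectic.exists_collarProfile`). [cite: Kas1980, §2] [cite: GompfStipsiczGSM1999, §8.2] -/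
theorem hasHandleDecomposition_fibreMorse (P : PALF o b) :
    ∃ (c₀ : EuclideanSpace ℝ (Fin 2)) (hc : c₀ ∉ P.f '' ↑P.crit)
      (m : RegularFibreOn (P.isRegularFibreOn_interior hc) → ℝ),
      IsMorse (𝓡 2) m ∧ {q | IsMCriticalPt (𝓡 2) m q}.Finite ∧
      HasHandleDecomposition 3 W
        (fun k => (criticalSetOfIndex (𝓡 2) m k).ncard + if k = 2 then P.crit.card else 0) := by
  obtain ⟨D, c₀, hc, c, s₁, -, hc0, hcs₁, hreg, hmain⟩ := P.hasHandleDecomposition_of_fibreMorse one_pos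
  obtain ⟨bb, hbb, hbb1, -, hbb_const, hbb'⟩ := exists_collarProfile hc0
  obtain ⟨m, hm, hmcol, hmcrit⟩ := P.exists_fibreMorse D hc hreg hc0 hcs₁ hbb hbb1
    (fun t ht => (hbb' t ht).ne)
  refine ⟨c₀, hc, m, hm, ?_, hmain bb hbb hbb_const hbb' m hm hmcol hmcrit⟩
  -- finiteness: critical points are isolated and lie in the compact `{τ ≥ 3c/2}`
  have h2 : (2 : WithTop ℕ∞) ≤ ∞ := by norm_cast
  have hK := P.isCompact_tau_preimage_Ici D hc (c := 3 * c / 2) (by linarith)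
  have hcl : IsClosed {q : RegularFibreOn (P.isRegularFibreOn_interior hc) | IsMCriticalPt (𝓡 2) m q} :=
    isClosed_criticalSet_of_contMDiff hm.1 h2
  have hcpt := hK.of_isClosed_subset hcl fun q hq => (hmcrit q hq).le
  obtain ⟨t, -, hcover⟩ := hcpt.elim_nhds_subcover
    (fun p => {x | x = p ∨ ¬ IsMCriticalPt (𝓡 2) m x}) fun p hp => by
      have := eventually_not_isMCriticalPt_of_nondegenerate hm.1 h2 hp (hm.2 p hp)
      rw [eventually_nhdsWithin_iff] at this
      filter_upwards [this] with x hx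
      by_cases hxp : x = p
      · exact Or.inl hxp
      · exact Or.inr (hx hxp)
  refine t.finite_toSet.subset fun x hx => ?_
  obtain ⟨p, hp, hxp⟩ := mem_iUnion₂.1 (hcover hx)
  rcases hxp with h | h
  · rw [h]; exact hp
  · exact absurd hx h

end Main

end PALF

end Literature.Geometry.Symplectic

end
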